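import Mathlib
import HarnessLib
import Literature.Probability.Process.PointStationaryLaw
import Literature.MathematicalPhysics.StatisticalMechanics.LocalMatchingCompactness
import Summits.AtomisticToContinuum.Crystallization.Theorems.FrustratedLawDichotomyNashLocalStability

/-!
# Crux `AperiodicFrustratedLawGap` — the Nash clause at the law level: the SECOND-ORDER PALM MOMENT INEQUALITY

Route `FrustratedLawDichotomy` (and `PeriodicChargeSplit`), crux `AperiodicFrustratedLawGap`
(item `stmt-AtomisticToContinuum-27623`); hand-1 lane.  ROUTE-INDEPENDENT (no `Theses` import; `MuGroundStateConfiguration`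
side).  Integrating the pointwise Laplacian stability at the ROOT
(`FrustratedLawDichotomyNashLocalStability.laplacian_nonneg_of_nash` at `p = 0`) against the law gives, for every law `P` on
configurations that is a.s. rooted `δ`-hard-core (clause (a)) and a.s. Nash (clause (e)):

* `lintegral_invPow_eight_le_of_nash` (pointwise): `5 ∫⁻ ‖y‖⁻⁸ dμ ≤ 11 ∫⁻ ‖y‖⁻¹⁴ dμ` (the root's own term vanishes,
  `‖0‖⁻¹ = 0`);
* `palm_moment_ineq_of_nash` (law level): `5 ∫⁻∫⁻ ‖y‖⁻⁸ dμ dP ≤ 11 ∫⁻∫⁻ ‖y‖⁻¹⁴ dμ dP` — in the `ℝ≥0∞` Lebesgue form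
  (no integrability bookkeeping; both sides are finite for hard-core probability laws by shell counting, not needed here).

This is the second-order companion of hand-2's first-order Palm identities for MINIMISING laws (virial
`∫∫‖y‖⁻⁶ = ∫∫‖y‖⁻¹²`, zero Palm stress), but needs only Nash, not minimality.  Book-keeping inputs: hard-core sets in
`ℝ³` are countable (finite in every ball, `finite_of_forall_le_dist_of_subset_closedBall`; proved inline because the
tree's `countable_of_separated` lives in a `MuGSC`-side module), so `∫⁻ · d(count|S)` is a `tsum` over `S`
(`lintegral_countable`).  All `[folklore]`.
-/

noncomputable section

open Metric Filter Topology MeasureTheory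
open scoped ENNReal

namespace Summit.AtomisticToContinuum.Crystallization.Theorems.FrustratedLawDichotomyNashStabilityMoments

open Literature.MathematicalPhysics.StatisticalMechanics (lennardJones finite_of_forall_le_dist_of_subset_closedBall)
open Literature.Probability.Process (IsRootedHardCore count_restrict_singleton_ne_zero_iff)
open Summit.AtomisticToContinuum.Crystallization.Theorems.FrustratedLawDichotomyNashLocalStability
  (summable_inv_pow_six_of_sep laplacian_nonneg_of_nash)

/-- `y ↦ ‖y‖⁻ᵏ` (as `ℝ≥0∞`) is measurable. [folklore] -/
theorem measurable_ofReal_invPow (k : ℕ) :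
    Measurable fun y : EuclideanSpace ℝ (Fin 3) => ENNReal.ofReal (‖y‖⁻¹ ^ k) :=
  (measurable_norm.inv.pow_const k).ennreal_ofReal

/-- **The inverse-power Palm functional as a series over the other atoms.**  For a rooted hard-core configuration
`μ = count|S` (`δ > 0`) and `k ≥ 1`, `∫⁻ ‖y‖⁻ᵏ dμ = ofReal (Σ'_{q ≠ 0 atom} ‖q‖⁻ᵏ)` provided the real series is
summable (the root contributes `‖0‖⁻ᵏ = 0`). [folklore] -/
theorem lintegral_invPow_eq_ofReal_tsum {δ : ℝ} (hδ : 0 < δ) {μ : Measure (EuclideanSpace ℝ (Fin 3))}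
    (hμ : IsRootedHardCore δ μ) {k : ℕ} (hk : k ≠ 0)
    (hs : Summable fun q : {q : EuclideanSpace ℝ (Fin 3) // μ {q} ≠ 0 ∧ q ≠ 0} =>
      ‖(q : EuclideanSpace ℝ (Fin 3))‖⁻¹ ^ k) :
    ∫⁻ y, ENNReal.ofReal (‖y‖⁻¹ ^ k) ∂μ =
      ENNReal.ofReal (∑' q : {q : EuclideanSpace ℝ (Fin 3) // μ {q} ≠ 0 ∧ q ≠ 0},
        ‖(q : EuclideanSpace ℝ (Fin 3))‖⁻¹ ^ k) := by
  obtain ⟨S, h0, hsep, rfl⟩ := hμ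
  have hmem := count_restrict_singleton_ne_zero_iff (E := EuclideanSpace ℝ (Fin 3)) S
  -- `S` is countable: finite in every ball (the tree's `ChartedPlanarOrderEnvelopeTransport.countable_of_separated`
  -- says the same but lives in a `MuGSC`-side module that cannot be imported next to `MuGroundStateConfiguration`)
  have hS : S.Countable := by
    have hcov : S = ⋃ n : ℕ, S ∩ closedBall (0 : EuclideanSpace ℝ (Fin 3)) n := by
      ext x
      simp only [Set.mem_iUnion, Set.mem_inter_iff, mem_closedBall]
      constructor
      · intro hx
        obtain ⟨n, hn⟩ := exists_nat_ge (dist x 0)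
        exact ⟨n, hx, hn⟩
      · rintro ⟨n, hx, -⟩
        exact hx
    rw [hcov]
    refine Set.countable_iUnion fun n => Set.Finite.countable ?_
    exact finite_of_forall_le_dist_of_subset_closedBall hδ
      (fun p hp q hq hpq => hsep p hp.1 q hq.1 hpq) Set.inter_subset_right
  -- `∫⁻ d(count|S)` as a series over `S`
  rw [lintegral_countable _ hS]
  simp only [Measure.count_singleton, mul_one]
  -- both series are the full-space series of the same function (the root term vanishes)
  set F : EuclideanSpace ℝ (Fin 3) → ℝ≥0∞ := fun y => ENNReal.ofReal (‖y‖⁻¹ ^ k) with hF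
  set Y : Set (EuclideanSpace ℝ (Fin 3)) :=
    {q | (Measure.count : Measure (EuclideanSpace ℝ (Fin 3))).restrict S {q} ≠ 0 ∧ q ≠ 0} with hY
  have hind : S.indicator F = Y.indicator F := by
    funext y
    by_cases hy0 : y = 0
    · subst hy0
      have hF0 : F 0 = 0 := by simp [hF, hk]
      simp [Set.indicator, hF0]
    · by_cases hyS : y ∈ S
      · have hyY : y ∈ Y := ⟨(hmem y).2 hyS, hy0⟩
        rw [Set.indicator_of_mem hyS, Set.indicator_of_mem hyY]
      · have hyY : y ∉ Y := fun h => hyS ((hmem y).1 h.1)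
        rw [Set.indicator_of_notMem hyS, Set.indicator_of_notMem hyY]
  have h1 : ∑' a : S, F a = ∑' q : Y, F q := by
    rw [tsum_subtype S F, tsum_subtype Y F, hind]
  rw [show (∑' a : S, ENNReal.ofReal (‖(a : EuclideanSpace ℝ (Fin 3))‖⁻¹ ^ k)) = ∑' a : S, F a from rfl, h1]
  exact (ENNReal.ofReal_tsum_of_nonneg (fun q => by positivity) hs).symm

/-- **Second-order Palm moment inequality (pointwise).**  For a rooted `δ`-hard-core configuration (`δ > 0`) whose
root passes the one-particle Nash test of the crux, `5 ∫⁻ ‖y‖⁻⁸ dμ ≤ 11 ∫⁻ ‖y‖⁻¹⁴ dμ` (Laplacian stability at the root,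
`laplacian_nonneg_of_nash`, integrated against the counting measure). [folklore] -/
theorem lintegral_invPow_eight_le_of_nash {δ : ℝ} (hδ : 0 < δ) {μ : Measure (EuclideanSpace ℝ (Fin 3))}
    (hμ : IsRootedHardCore δ μ)
    (hNash : ∀ y : EuclideanSpace ℝ (Fin 3), (∀ q : EuclideanSpace ℝ (Fin 3), μ {q} ≠ 0 → q ≠ 0 → y ≠ q) →
      ∑' q : {q : EuclideanSpace ℝ (Fin 3) // μ {q} ≠ 0 ∧ q ≠ 0}, lennardJones (dist 0 (q : EuclideanSpace ℝ (Fin 3))) ≤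
        ∑' q : {q : EuclideanSpace ℝ (Fin 3) // μ {q} ≠ 0 ∧ q ≠ 0}, lennardJones (dist y (q : EuclideanSpace ℝ (Fin 3)))) :
    5 * ∫⁻ y, ENNReal.ofReal (‖y‖⁻¹ ^ 8) ∂μ ≤ 11 * ∫⁻ y, ENNReal.ofReal (‖y‖⁻¹ ^ 14) ∂μ := by
  have h0 : μ {0} ≠ 0 := by rw [hμ.measure_zero_singleton]; exact one_ne_zero
  obtain ⟨L, hL, hsum⟩ := laplacian_nonneg_of_nash hδ hμ h0 hNash
  -- separation facts
  obtain ⟨S, hS0, hsep, hμS⟩ := hμ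
  have hmem : ∀ q : EuclideanSpace ℝ (Fin 3), μ {q} ≠ 0 ↔ q ∈ S := by
    intro q; rw [hμS]; exact count_restrict_singleton_ne_zero_iff S q
  have hfar : ∀ q : {q : EuclideanSpace ℝ (Fin 3) // μ {q} ≠ 0 ∧ q ≠ 0}, δ ≤ ‖(q : EuclideanSpace ℝ (Fin 3))‖ := by
    intro q
    have := hsep (q : EuclideanSpace ℝ (Fin 3)) ((hmem q).1 q.2.1) 0 hS0 q.2.2
    rwa [dist_zero_right] at this
  -- summability of `‖q‖⁻⁸`, `‖q‖⁻¹⁴` over the other atoms (domination by `‖q‖⁻⁶`)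
  have h6 : Summable fun q : {q : EuclideanSpace ℝ (Fin 3) // μ {q} ≠ 0 ∧ q ≠ 0} =>
      (dist (0 : EuclideanSpace ℝ (Fin 3)) (q : EuclideanSpace ℝ (Fin 3)))⁻¹ ^ 6 := by
    have h := summable_inv_pow_six_of_sep (S := S) (Y := {q | μ {q} ≠ 0 ∧ q ≠ 0}) (p := 0) hδ hsep
      (fun q hq => (hmem q).1 hq.1) (fun q hq => by
        have := hsep q ((hmem q).1 hq.1) 0 hS0 hq.2
        rwa [dist_comm] at this)
    exact h
  have hdom : ∀ (j : ℕ) (q : {q : EuclideanSpace ℝ (Fin 3) // μ {q} ≠ 0 ∧ q ≠ 0}),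
      ‖(q : EuclideanSpace ℝ (Fin 3))‖⁻¹ ^ (j + 6) ≤ δ⁻¹ ^ j * (dist (0 : EuclideanSpace ℝ (Fin 3)) (q : EuclideanSpace ℝ (Fin 3)))⁻¹ ^ 6 := by
    intro j q
    have hq0 : 0 < ‖(q : EuclideanSpace ℝ (Fin 3))‖ := hδ.trans_le (hfar q)
    have hi0 : 0 ≤ ‖(q : EuclideanSpace ℝ (Fin 3))‖⁻¹ := inv_nonneg.2 hq0.le
    have hi1 : ‖(q : EuclideanSpace ℝ (Fin 3))‖⁻¹ ≤ δ⁻¹ := (inv_le_inv₀ hq0 hδ).2 (hfar q)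
    rw [dist_zero_left, pow_add]
    exact mul_le_mul_of_nonneg_right (pow_le_pow_left₀ hi0 hi1 j) (pow_nonneg hi0 6)
  have hsumm : ∀ j : ℕ, Summable fun q : {q : EuclideanSpace ℝ (Fin 3) // μ {q} ≠ 0 ∧ q ≠ 0} =>
      ‖(q : EuclideanSpace ℝ (Fin 3))‖⁻¹ ^ (j + 6) := fun j =>
    Summable.of_nonneg_of_le (fun q => by positivity) (hdom j) (h6.mul_left (δ⁻¹ ^ j))
  have hs8 : Summable fun q : {q : EuclideanSpace ℝ (Fin 3) // μ {q} ≠ 0 ∧ q ≠ 0} =>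
      ‖(q : EuclideanSpace ℝ (Fin 3))‖⁻¹ ^ 8 := hsumm 2
  have hs14 : Summable fun q : {q : EuclideanSpace ℝ (Fin 3) // μ {q} ≠ 0 ∧ q ≠ 0} =>
      ‖(q : EuclideanSpace ℝ (Fin 3))‖⁻¹ ^ 14 := hsumm 8
  -- the real inequality `5 Σ‖q‖⁻⁸ ≤ 11 Σ‖q‖⁻¹⁴`
  have hreal : 5 * ∑' q : {q : EuclideanSpace ℝ (Fin 3) // μ {q} ≠ 0 ∧ q ≠ 0}, ‖(q : EuclideanSpace ℝ (Fin 3))‖⁻¹ ^ 8 ≤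
      11 * ∑' q : {q : EuclideanSpace ℝ (Fin 3) // μ {q} ≠ 0 ∧ q ≠ 0}, ‖(q : EuclideanSpace ℝ (Fin 3))‖⁻¹ ^ 14 := by
    have hsum' : HasSum (fun q : {q : EuclideanSpace ℝ (Fin 3) // μ {q} ≠ 0 ∧ q ≠ 0} =>
        11 * ‖(q : EuclideanSpace ℝ (Fin 3))‖⁻¹ ^ 14 - 5 * ‖(q : EuclideanSpace ℝ (Fin 3))‖⁻¹ ^ 8) L := by
      refine hsum.congr_fun fun q => ?_
      rw [dist_zero_left]
    have h2 : HasSum (fun q : {q : EuclideanSpace ℝ (Fin 3) // μ {q} ≠ 0 ∧ q ≠ 0} =>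
        11 * ‖(q : EuclideanSpace ℝ (Fin 3))‖⁻¹ ^ 14 - 5 * ‖(q : EuclideanSpace ℝ (Fin 3))‖⁻¹ ^ 8)
        (11 * ∑' q : {q : EuclideanSpace ℝ (Fin 3) // μ {q} ≠ 0 ∧ q ≠ 0}, ‖(q : EuclideanSpace ℝ (Fin 3))‖⁻¹ ^ 14 -
          5 * ∑' q : {q : EuclideanSpace ℝ (Fin 3) // μ {q} ≠ 0 ∧ q ≠ 0}, ‖(q : EuclideanSpace ℝ (Fin 3))‖⁻¹ ^ 8) :=
      (hs14.hasSum.mul_left 11).sub (hs8.hasSum.mul_left 5)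
    have := hsum'.unique h2
    linarith
  -- back to `ℝ≥0∞`
  have hμ' : IsRootedHardCore δ μ := ⟨S, hS0, hsep, hμS⟩
  rw [lintegral_invPow_eq_ofReal_tsum hδ hμ' (by norm_num) hs8, lintegral_invPow_eq_ofReal_tsum hδ hμ' (by norm_num) hs14,
    ← ENNReal.ofReal_ofNat 5, ← ENNReal.ofReal_ofNat 11, ← ENNReal.ofReal_mul (by norm_num),
    ← ENNReal.ofReal_mul (by norm_num)]
  exact ENNReal.ofReal_le_ofReal hreal

/-- **Second-order Palm moment inequality (law level).**  If `P`-almost every configuration is rooted `δ`-hard-core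
(`δ > 0`, clause (a)) and `P`-almost every configuration is Nash (clause (e) of the crux, verbatim), then
`5 ∫⁻∫⁻ ‖y‖⁻⁸ dμ dP ≤ 11 ∫⁻∫⁻ ‖y‖⁻¹⁴ dμ dP`. [folklore] -/
theorem palm_moment_ineq_of_nash {δ : ℝ} (hδ : 0 < δ) {P : Measure (Measure (EuclideanSpace ℝ (Fin 3)))}
    (ha : ∀ᵐ μ ∂P, IsRootedHardCore δ μ)
    (he : ∀ᵐ μ ∂P, ∀ p : EuclideanSpace ℝ (Fin 3), μ {p} ≠ 0 → ∀ y : EuclideanSpace ℝ (Fin 3),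
      (∀ q : EuclideanSpace ℝ (Fin 3), μ {q} ≠ 0 → q ≠ p → y ≠ q) →
      ∑' q : {q : EuclideanSpace ℝ (Fin 3) // μ {q} ≠ 0 ∧ q ≠ p},
          lennardJones (dist p (q : EuclideanSpace ℝ (Fin 3))) ≤
        ∑' q : {q : EuclideanSpace ℝ (Fin 3) // μ {q} ≠ 0 ∧ q ≠ p},
          lennardJones (dist y (q : EuclideanSpace ℝ (Fin 3)))) :
    5 * ∫⁻ μ, ∫⁻ y, ENNReal.ofReal (‖y‖⁻¹ ^ 8) ∂μ ∂P ≤ 11 * ∫⁻ μ, ∫⁻ y, ENNReal.ofReal (‖y‖⁻¹ ^ 14) ∂μ ∂P := by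
  rw [← lintegral_const_mul _ (Measure.measurable_lintegral (measurable_ofReal_invPow 8)),
    ← lintegral_const_mul _ (Measure.measurable_lintegral (measurable_ofReal_invPow 14))]
  refine lintegral_mono_ae ?_
  filter_upwards [ha, he] with μ hμ hN
  have h0 : μ {0} ≠ 0 := by rw [hμ.measure_zero_singleton]; exact one_ne_zero
  exact lintegral_invPow_eight_le_of_nash hδ hμ (hN 0 h0)

end Summit.AtomisticToContinuum.Crystallization.Theorems.FrustratedLawDichotomyNashStabilityMoments

end
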